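import Summits.Ventures.HodgeRepro2.T5DoublingRestriction

/-!
# Characters of the unitary group of ANY split hermitian plane are `ν ∘ det`

Kernel support (seat p3, cell pub-hodge-repro2) behind §F.1 of `route/T5-route-3.md`: «A character
of `U(W)` (`W` split, `n ≥ 2`; `U/SU ≅ E¹` by det and `SU = [U,U]`) is `ν′∘det` for a character `ν′`
of `E¹`». Files 74 / 75 proved this for the MODEL `U(ℍ)`, file 82 showed that every non-degenerate
hermitian plane `H` with an isotropic vector is `P`-isometric to `ℍ`, and file 85 transported the
factorisation to the doubled plane `diag(a, −a)`. This file states the transport for an ARBITRARY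
split plane `H` (the datum's `W₁₂,v` in any Gram matrix), once and for all:

* `exists_factor_det_of_isotropic`: every character of `U(H)` is `ν ∘ det` for a character `ν`
  of `E¹`, `ν` unique (`factor_det_unique_of_isotropic`);
* `detNormOneOf_surjective_of_isotropic`: `det : U(H) → E¹` is onto («`det(M_Y) = E¹`»);
* `ker_det_eq_commutator_of_isotropic`: `SU(H) = [U(H), U(H)]` (file 75's `commutator_eq_ker_det`
  transported along the isomorphism);
* `map_eq_one_of_det_eq_one_of_isotropic`: a character of `U(H)` is trivial on `SU(H)`.

The hypotheses are those of files 74 / 75 / 82: `E` a field with a non-trivial involution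
(`∃ a, star a ≠ a`), a non-norm-one element (`∃ t ≠ 0, t·t̄ ≠ 1`), `Hᴴ = H`, `det H ≠ 0`, and a
non-zero isotropic vector. Header declaration (README §8(d)): uses an L-value-free non-vanishing
device: no.
-/

namespace Summit.Ventures.HodgeRepro2.T5SplitPlaneCharacters

open T5UnipotentCommutator T5SplitHermitianPlane T5HyperbolicDet T5HyperbolicCharacters
  T5DoublingRestriction T5NormOneCharacters ShimuraData.B3Characters Matrix

variable {E : Type*} [Field E] [StarRing E]

/-- `U(ℍ) ≅ U(H)` along a hyperbolic basis `P` of `H`. -/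
noncomputable def unitaryEquivOfBasis (H : Matrix (Fin 2) (Fin 2) E) (P : GL (Fin 2) E)
    (hP : (P : Matrix (Fin 2) (Fin 2) E)ᴴ * H * (P : Matrix (Fin 2) (Fin 2) E) = hyp) :
    hypUnitary E ≃* unitaryOf H :=
  (MulEquiv.subgroupCongr hypUnitary_eq_unitaryOf).trans (unitaryOfEquiv P hP)

/-- The transport is conjugation by `P`. -/
theorem coe_unitaryEquivOfBasis (H : Matrix (Fin 2) (Fin 2) E) (P : GL (Fin 2) E)
    (hP : (P : Matrix (Fin 2) (Fin 2) E)ᴴ * H * (P : Matrix (Fin 2) (Fin 2) E) = hyp)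
    (g : hypUnitary E) :
    ((unitaryEquivOfBasis H P hP g : unitaryOf H) : GL (Fin 2) E) = P * g * P⁻¹ :=
  rfl

/-- The determinant is preserved by the transport. -/
theorem detNormOneOf_unitaryEquivOfBasis (H : Matrix (Fin 2) (Fin 2) E) (hdet : H.det ≠ 0)
    (P : GL (Fin 2) E)
    (hP : (P : Matrix (Fin 2) (Fin 2) E)ᴴ * H * (P : Matrix (Fin 2) (Fin 2) E) = hyp)
    (g : hypUnitary E) :
    detNormOneOf H hdet (unitaryEquivOfBasis H P hP g) = detNormOne g := by
  apply Subtype.ext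
  apply Units.ext
  change ((((unitaryEquivOfBasis H P hP g : unitaryOf H) : GL (Fin 2) E) :
    Matrix (Fin 2) (Fin 2) E)).det = ((g : GL (Fin 2) E) : Matrix (Fin 2) (Fin 2) E).det
  rw [coe_unitaryEquivOfBasis, Units.val_mul, Units.val_mul, det_mul, det_mul]
  have h1 : ((P⁻¹ : GL (Fin 2) E) : Matrix (Fin 2) (Fin 2) E).det *
      (P : Matrix (Fin 2) (Fin 2) E).det = 1 := by
    rw [← det_mul]
    simp
  calc (P : Matrix (Fin 2) (Fin 2) E).det * ((g : GL (Fin 2) E) : Matrix (Fin 2) (Fin 2) E).det *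
        ((P⁻¹ : GL (Fin 2) E) : Matrix (Fin 2) (Fin 2) E).det
      = ((g : GL (Fin 2) E) : Matrix (Fin 2) (Fin 2) E).det *
          (((P⁻¹ : GL (Fin 2) E) : Matrix (Fin 2) (Fin 2) E).det *
            (P : Matrix (Fin 2) (Fin 2) E).det) := by ring
    _ = ((g : GL (Fin 2) E) : Matrix (Fin 2) (Fin 2) E).det := by rw [h1, mul_one]

section Isotropic

variable (hne : ∃ a : E, star a ≠ a) (H : Matrix (Fin 2) (Fin 2) E) (hH : Hᴴ = H)
  (hdet : H.det ≠ 0) (v : Fin 2 → E) (hv : v ≠ 0) (hiso : gramForm H v v = 0)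

include hne hH hv hiso

/-- «`det(M_Y) = E¹`» on any split plane: `det : U(H) → E¹` is onto. -/
theorem detNormOneOf_surjective_of_isotropic :
    Function.Surjective (detNormOneOf H hdet) := by
  obtain ⟨P, hP⟩ := exists_hyperbolic_basis hne H hH hdet v hv hiso
  intro y
  obtain ⟨g, hg⟩ := detNormOne_surjective hne y
  exact ⟨unitaryEquivOfBasis H P hP g, by rw [detNormOneOf_unitaryEquivOfBasis H hdet P hP, hg]⟩

variable {M : Type*} [CommGroup M]

/-- THE FACTORISATION THEOREM ON ANY SPLIT PLANE: every character of `U(H)` is `ν ∘ det` for a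
character `ν` of `E¹`. -/
theorem exists_factor_det_of_isotropic (ht : ∃ t : E, t ≠ 0 ∧ t * star t ≠ 1)
    (φ : unitaryOf H →* M) :
    ∃ ν : normOne (unitsConj (starRingAut (R := E))) →* M,
      ∀ g : unitaryOf H, φ g = ν (detNormOneOf H hdet g) := by
  obtain ⟨P, hP⟩ := exists_hyperbolic_basis hne H hH hdet v hv hiso
  obtain ⟨ν, hν⟩ := exists_factor_det hne ht (φ.comp (unitaryEquivOfBasis H P hP).toMonoidHom)
  refine ⟨ν, fun g => ?_⟩
  have hg : unitaryEquivOfBasis H P hP ((unitaryEquivOfBasis H P hP).symm g) = g :=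
    (unitaryEquivOfBasis H P hP).apply_symm_apply g
  have h1 := hν ((unitaryEquivOfBasis H P hP).symm g)
  rw [MonoidHom.comp_apply, MulEquiv.coe_toMonoidHom, hg] at h1
  rw [h1, ← detNormOneOf_unitaryEquivOfBasis H hdet P hP, hg]

/-- The factor is unique (`det` is onto `E¹`). -/
theorem factor_det_unique_of_isotropic (ν₁ ν₂ : normOne (unitsConj (starRingAut (R := E))) →* M)
    (h : ∀ g : unitaryOf H, ν₁ (detNormOneOf H hdet g) = ν₂ (detNormOneOf H hdet g)) : ν₁ = ν₂ := by
  apply MonoidHom.ext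
  intro y
  obtain ⟨g, rfl⟩ := detNormOneOf_surjective_of_isotropic hne H hH hdet v hv hiso y
  exact h g

/-- A character of `U(H)` is trivial on `SU(H) = ker det`. -/
theorem map_eq_one_of_det_eq_one_of_isotropic (ht : ∃ t : E, t ≠ 0 ∧ t * star t ≠ 1)
    (φ : unitaryOf H →* M) (g : unitaryOf H) (hg : detNormOneOf H hdet g = 1) : φ g = 1 := by
  obtain ⟨ν, hν⟩ := exists_factor_det_of_isotropic hne H hH hdet v hv hiso ht φ
  rw [hν, hg, map_one]

omit hne hH hv hiso in
/-- «`SU = [U, U]`» on any split plane, first half: a character into a commutative group kills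
the commutator subgroup, so `[U(H), U(H)] ≤ ker det` (no isotropy needed). -/
theorem commutator_le_ker_det :
    commutator (unitaryOf H) ≤ (detNormOneOf H hdet).ker :=
  Abelianization.commutator_subset_ker _

/-- «`SU = [U, U]`» on any split plane, second half: `ker det ≤ [U(H), U(H)]` — apply the
factorisation theorem to `Abelianization.of` (file 75's argument, transported). -/
theorem ker_det_le_commutator_of_isotropic (ht : ∃ t : E, t ≠ 0 ∧ t * star t ≠ 1) :
    (detNormOneOf H hdet).ker ≤ commutator (unitaryOf H) := by
  intro g hg
  rw [MonoidHom.mem_ker] at hg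
  rw [← Abelianization.ker_of, MonoidHom.mem_ker]
  exact map_eq_one_of_det_eq_one_of_isotropic hne H hH hdet v hv hiso ht Abelianization.of g hg

/-- «`SU = [U, U]`» on any split plane: the kernel of `det` is the commutator subgroup of `U(H)`. -/
theorem ker_det_eq_commutator_of_isotropic (ht : ∃ t : E, t ≠ 0 ∧ t * star t ≠ 1) :
    (detNormOneOf H hdet).ker = commutator (unitaryOf H) :=
  le_antisymm (ker_det_le_commutator_of_isotropic hne H hH hdet v hv hiso ht)
    (commutator_le_ker_det H hdet)

end Isotropic

end Summit.Ventures.HodgeRepro2.T5SplitPlaneCharacters
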